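import Summits.NavierStokesRegularity.FluidComputer.BlockReadout

/-!
# Fourier-block design, III: the hand-off axiom

HONEST FRAMING (cell `pub-fluidc`, verbatim): *low prior, high value-of-information experiment on
Tao's machine paradigm; NOT a claim that NS blows up.*

The one non-trivial static axiom of `ShadowedCircuit`, for the concrete Fourier-block design of
`BlockReadout`: **hand-off** — a state whose generation-`n` readout is an output
(`|a_n| ≤ σsp`, `a_{n+1} ∈ [aLo, aHi]`) and whose generation-`n` junk is `≤ jrun √E_n` is read by
generation `n+1` inside the loaded core, with generation-`(n+1)` junk `≤ jcore √E_{n+1}`.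

Mechanism (this is where the forgetting barrier F2 of `Forgetting.lean` is met): the junk weight
`(max(|ξ|,μ)/λ_n)^s` is HOMOGENEOUS in the machine scale, so re-basing from `λ_n` to
`λ_{n+1} = 2λ_n` discounts every frequency by exactly `2^{-s}` (`J_two_mul`), and the spent input
block — which generation `n+1` no longer models as design content and therefore books as junk — sits
at `|ξ| ≤ (3/2)·2ⁿ`, where the new weight is `≤ (3/4)^s` (`J_smul_wavelet_le`). With the budget
inequality `erasure` of `Params` (`((1/2)^s + (3/4)^s)·jrun + (3/4)^s·σsp ≤ jcore·√η`) the
discounted junk fits under the next core threshold; with `next_output` (`jrun ≤ c0·η·4^s`) the old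
junk bound controls the amplitude two blocks up (`4^s |⟨v,ψ_{n+2}⟩| ≤ J_n`, weight `≥ 4^s` there),
so the new output coordinate is `≤ c0`. No statement about the Navier–Stokes PDE is made here.
-/

noncomputable section

open MeasureTheory Set Filter Topology Metric
open scoped ENNReal NNReal SchwartzMap

namespace Summit.NavierStokesRegularity.FluidComputer

open Literature.Analysis.FluidPDE.Tao2016
open Literature.Analysis.FluidPDE.FluidComputer

namespace BlockDesign

variable {𝒟 : CascadeWaveletData 1 1} {S : CascadeSpecs} {P : Params S}

/-! ### §1. The junk weight on the three relevant wavelet regions -/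

/-- A lower bound `M ≤ w` on the region of `ψ_k` gives `M |⟨z, ψ_k⟩| ≤ J(z)`. [folklore] -/
theorem enorm_coef_le_J (𝒟 : CascadeWaveletData 1 1) (k : ℕ) {μ κ s M : ℝ}
    (hMW : ∀ ξ ∈ freqRegion 𝒟 0 (k : ℤ), M ≤ (max ‖ξ‖ μ / κ) ^ s) (z : L2C) :
    ENNReal.ofReal M * ‖coef 𝒟 k z‖ₑ ≤ J μ κ s z :=
  mul_enorm_pairing_le_J 𝒟 two_pos' 0 (k : ℤ) hMW z

/-- An upper bound `w ≤ M'` on the region of `ψ_k` gives `J(c ψ_k) ≤ |c| M'`. [folklore] -/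
theorem J_smul_mode_le (𝒟 : CascadeWaveletData 1 1) (k : ℕ) {μ κ s M' : ℝ}
    (hMW : ∀ ξ ∈ freqRegion 𝒟 0 (k : ℤ), (max ‖ξ‖ μ / κ) ^ s ≤ M') (c : ℂ) :
    J μ κ s (c • mode 𝒟 k) ≤ ‖c‖ₑ * ENNReal.ofReal M' :=
  J_smul_wavelet_le 𝒟 two_pos' 0 (k : ℤ) hMW c

/-- On the region of `ψ_{n+2}` the generation-`n` weight is `≥ 4^s`. [folklore] -/
theorem weight_ge_region_add_two (P : Params S) (n : ℕ) {ξ : EuclideanSpace ℝ (Fin 3)}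
    (h : ξ ∈ freqRegion 𝒟 0 ((n + 2 : ℕ) : ℤ)) : (4 : ℝ) ^ P.s ≤ (max ‖ξ‖ P.μ / S.lam n) ^ P.s := by
  have h1 := (norm_of_mem_region 𝒟 (n + 2) h).1
  have h2n : (0 : ℝ) < 2 ^ n := pow_pos two_pos n
  refine Real.rpow_le_rpow (by norm_num) ?_ P.s_nonneg
  rw [P.lam_eq, le_div_iff₀ h2n]
  calc (4 : ℝ) * 2 ^ n = 2 ^ (n + 2) := by ring
    _ ≤ ‖ξ‖ := h1.le
    _ ≤ max ‖ξ‖ P.μ := le_max_left _ _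

/-- On the region of `ψ_n` the generation-`n` weight is `≥ 1`. [folklore] -/
theorem weight_ge_region_self (P : Params S) (n : ℕ) {ξ : EuclideanSpace ℝ (Fin 3)}
    (h : ξ ∈ freqRegion 𝒟 0 (n : ℤ)) : (1 : ℝ) ≤ (max ‖ξ‖ P.μ / S.lam n) ^ P.s := by
  have h1 := (norm_of_mem_region 𝒟 n h).1
  refine Real.one_le_rpow ?_ P.s_nonneg
  rw [P.lam_eq, le_div_iff₀ (pow_pos two_pos n), one_mul]
  exact h1.le.trans (le_max_left _ _)

/-- On the region of `ψ_n` the generation-`(n+1)` weight is `≤ (3/4)^s`. [folklore] -/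
theorem weight_le_region_prev (P : Params S) (n : ℕ) {ξ : EuclideanSpace ℝ (Fin 3)}
    (h : ξ ∈ freqRegion 𝒟 0 (n : ℤ)) :
    (max ‖ξ‖ P.μ / S.lam (n + 1)) ^ P.s ≤ (3 / 4 : ℝ) ^ P.s := by
  have h2 := (norm_of_mem_region 𝒟 n h).2
  have h2n : (1 : ℝ) ≤ 2 ^ n := one_le_pow₀ one_le_two
  refine Real.rpow_le_rpow (div_nonneg (le_max_of_le_left (norm_nonneg _)) (S.lam_pos _).le) ?_
    P.s_nonneg
  rw [P.lam_eq, div_le_iff₀ (pow_pos two_pos (n + 1))]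
  calc max ‖ξ‖ P.μ ≤ 2 ^ n * (3 / 2) := max_le h2 (P.μ_le_one.trans (by linarith))
    _ = 3 / 4 * 2 ^ (n + 1) := by ring

/-! ### §2. The junk bound controls the amplitude two blocks up -/

/-- `4^s |⟨v, ψ_{n+2}⟩| ≤ junk_n(v)`: design states of generation `n` have no `ψ_{n+2}`-component,
and the weight is `≥ 4^s` there. [folklore] -/
theorem enorm_coef_add_two_le_junk (n : ℕ) (v : L2C) :
    ENNReal.ofReal ((4 : ℝ) ^ P.s) * ‖coef 𝒟 (n + 2) v‖ₑ ≤ junk 𝒟 P n v := by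
  refine le_iInf fun p => ?_
  have hc : coef 𝒟 (n + 2) v = coef 𝒟 (n + 2) (v - recon 𝒟 S n p) := by
    rw [coef_sub, coef_recon_succ_succ, sub_zero]
  rw [hc]
  exact enorm_coef_le_J 𝒟 (n + 2) (fun ξ hξ => weight_ge_region_add_two P n hξ) _

/-- Real form: `4^s |⟨v, ψ_{n+2}⟩| ≤ jrun √E_n` under the running junk bound. [folklore] -/
theorem norm_coef_add_two_le (n : ℕ) (v : L2C)
    (hj : junk 𝒟 P n v ≤ ENNReal.ofReal (P.jrun * Real.sqrt (S.Emin n))) :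
    (4 : ℝ) ^ P.s * ‖coef 𝒟 (n + 2) v‖ ≤ P.jrun * Real.sqrt (S.Emin n) := by
  have h := (enorm_coef_add_two_le_junk (𝒟 := 𝒟) (P := P) n v).trans hj
  rwa [← ofReal_norm, ← ENNReal.ofReal_mul (Real.rpow_nonneg (by norm_num) _),
    ENNReal.ofReal_le_ofReal_iff (mul_nonneg P.jrun_pos.le (sqrt_Emin_pos S n).le)] at h

/-! ### §3. Hand-off -/

/-- The spent-block bookkeeping: for every generation-`n` design state `recon n (p₁,p₂)`,
`junk_{n+1}(v) ≤ ((1/2)^s + (3/4)^s)·J_n(v − recon n p) + (3/4)^s·σsp·√E_n`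
whenever `|Re⟨v,ψ_n⟩| ≤ σsp √E_n`. [folklore] -/
theorem junk_succ_le_of_design (n : ℕ) (v : L2C) (hσ : |(coef 𝒟 n v).re| ≤ P.σsp * Real.sqrt (S.Emin n))
    (p : ℝ × ℝ) :
    junk 𝒟 P (n + 1) v ≤
      (ENNReal.ofReal ((1 / 2 : ℝ) ^ P.s) + ENNReal.ofReal ((3 / 4 : ℝ) ^ P.s)) *
          J P.μ (S.lam n) P.s (v - recon 𝒟 S n p) +
        ENNReal.ofReal (P.σsp * Real.sqrt (S.Emin n)) * ENNReal.ofReal ((3 / 4 : ℝ) ^ P.s) := by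
  have hE := sqrt_Emin_pos S n
  have hσ0 : 0 ≤ P.σsp * Real.sqrt (S.Emin n) := (abs_nonneg _).trans hσ
  set z : L2C := v - recon 𝒟 S n p with hz
  set c : ℂ := ((p.1 * Real.sqrt (S.Emin n) : ℝ) : ℂ) with hc
  -- the module identity: erasing only the output block of the design state leaves `z + c ψ_n`
  have hsplit : v - recon 𝒟 S (n + 1) (p.2, 0) = z + c • mode 𝒟 n := by
    simp only [hz, hc, recon, zero_mul, Complex.ofReal_zero, zero_smul, add_zero]
    abel
  -- (A) the old junk, re-based: exact discount `2^{-s}`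
  have hA : J P.μ (S.lam (n + 1)) P.s z = ENNReal.ofReal ((1 / 2 : ℝ) ^ P.s) * J P.μ (S.lam n) P.s z := by
    rw [S.lam_succ]; exact J_two_mul P.μ (S.lam_pos n) P.s z
  -- (B) the spent input block, now junk: weight `≤ (3/4)^s`
  have hB : J P.μ (S.lam (n + 1)) P.s (c • mode 𝒟 n) ≤ ‖c‖ₑ * ENNReal.ofReal ((3 / 4 : ℝ) ^ P.s) :=
    J_smul_mode_le 𝒟 n (fun ξ hξ => weight_le_region_prev P n hξ) c
  -- (C) its amplitude: `|p₁| √E_n ≤ σsp √E_n + |⟨z, ψ_n⟩| ≤ σsp √E_n + J_n(z)`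
  have hC : ‖c‖ₑ ≤ ENNReal.ofReal (P.σsp * Real.sqrt (S.Emin n)) + J P.μ (S.lam n) P.s z := by
    have hre : p.1 * Real.sqrt (S.Emin n) = (coef 𝒟 n v).re - (coef 𝒟 n z).re := by
      rw [hz, coef_sub, coef_recon_self, Complex.sub_re, Complex.ofReal_re]; ring
    have hz1 := abs_le.1 (Complex.abs_re_le_norm (coef 𝒟 n z))
    have hv1 := abs_le.1 hσ
    have hreal : ‖c‖ ≤ P.σsp * Real.sqrt (S.Emin n) + ‖coef 𝒟 n z‖ := by
      rw [hc, Complex.norm_real, Real.norm_eq_abs, hre]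
      exact abs_le.2 ⟨by linarith, by linarith⟩
    have hJ : ‖coef 𝒟 n z‖ₑ ≤ J P.μ (S.lam n) P.s z := by
      have h := enorm_coef_le_J 𝒟 n (fun ξ hξ => weight_ge_region_self P n hξ) z
      rwa [ENNReal.ofReal_one, one_mul] at h
    calc ‖c‖ₑ = ENNReal.ofReal ‖c‖ := (ofReal_norm _).symm
      _ ≤ ENNReal.ofReal (P.σsp * Real.sqrt (S.Emin n) + ‖coef 𝒟 n z‖) :=
          ENNReal.ofReal_le_ofReal hreal
      _ = ENNReal.ofReal (P.σsp * Real.sqrt (S.Emin n)) + ‖coef 𝒟 n z‖ₑ := by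
          rw [ENNReal.ofReal_add hσ0 (norm_nonneg _), ofReal_norm]
      _ ≤ _ := add_le_add le_rfl hJ
  calc junk 𝒟 P (n + 1) v ≤ J P.μ (S.lam (n + 1)) P.s (v - recon 𝒟 S (n + 1) (p.2, 0)) := iInf_le _ _
    _ = J P.μ (S.lam (n + 1)) P.s (z + c • mode 𝒟 n) := by rw [hsplit]
    _ ≤ J P.μ (S.lam (n + 1)) P.s z + J P.μ (S.lam (n + 1)) P.s (c • mode 𝒟 n) := J_add_le _ _ _ _ _
    _ ≤ ENNReal.ofReal ((1 / 2 : ℝ) ^ P.s) * J P.μ (S.lam n) P.s z +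
          (ENNReal.ofReal (P.σsp * Real.sqrt (S.Emin n)) + J P.μ (S.lam n) P.s z) *
            ENNReal.ofReal ((3 / 4 : ℝ) ^ P.s) := by
        rw [hA]
        exact add_le_add le_rfl (hB.trans (mul_le_mul' hC le_rfl))
    _ = _ := by ring

/-- **Hand-off** (`ShadowedCircuit.handoff` for the Fourier-block design). [folklore] -/
theorem handoff (n : ℕ) (v : L2C) (hv : read 𝒟 S n v ∈ Aout P)
    (hj : junk 𝒟 P n v ≤ ENNReal.ofReal (P.jrun * Real.sqrt (S.Emin n))) :
    read 𝒟 S (n + 1) v ∈ Acore P ∧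
      junk 𝒟 P (n + 1) v ≤ ENNReal.ofReal (P.jcore * Real.sqrt (S.Emin (n + 1))) := by
  have hE := sqrt_Emin_pos S n
  have h4 : (0 : ℝ) < (4 : ℝ) ^ P.s := Real.rpow_pos_of_pos (by norm_num) _
  obtain ⟨h1, h2⟩ := hv
  -- the spent input amplitude
  have hσ : |(coef 𝒟 n v).re| ≤ P.σsp * Real.sqrt (S.Emin n) := by
    have h := abs_le.2 ⟨h1.1, h1.2⟩
    change |(coef 𝒟 n v).re / Real.sqrt (S.Emin n)| ≤ P.σsp at h
    rwa [abs_div, abs_of_pos hE, div_le_iff₀ hE] at h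
  refine ⟨⟨h2, ?_⟩, ?_⟩
  · -- new output coordinate: `|Re⟨v,ψ_{n+2}⟩| / √E_{n+2} ≤ jrun / (4^s η) ≤ c0`
    have key : |(coef 𝒟 (n + 2) v).re / Real.sqrt (S.Emin (n + 2))| ≤ P.c0 := by
      have hE2 := sqrt_Emin_pos S (n + 2)
      rw [abs_div, abs_of_pos hE2, div_le_iff₀ hE2, sqrt_Emin_succ_succ]
      have hc := norm_coef_add_two_le (𝒟 := 𝒟) (P := P) n v hj
      calc |(coef 𝒟 (n + 2) v).re| ≤ ‖coef 𝒟 (n + 2) v‖ := Complex.abs_re_le_norm _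
        _ ≤ P.jrun * Real.sqrt (S.Emin n) / (4 : ℝ) ^ P.s := by
            rw [le_div_iff₀ h4, mul_comm]; exact hc
        _ ≤ P.c0 * S.eta * (4 : ℝ) ^ P.s * Real.sqrt (S.Emin n) / (4 : ℝ) ^ P.s :=
            div_le_div_of_nonneg_right (mul_le_mul_of_nonneg_right P.next_output hE.le) h4.le
        _ = P.c0 * (S.eta * Real.sqrt (S.Emin n)) := by field_simp
    exact abs_le.1 key
  · -- new junk: `inf` over the old design states of the spent-block bookkeeping, then `erasure`
    set K : ℝ≥0∞ := ENNReal.ofReal ((1 / 2 : ℝ) ^ P.s) + ENNReal.ofReal ((3 / 4 : ℝ) ^ P.s) with hK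
    set L : ℝ≥0∞ := ENNReal.ofReal (P.σsp * Real.sqrt (S.Emin n)) * ENNReal.ofReal ((3 / 4 : ℝ) ^ P.s)
      with hL
    have h12 : (0 : ℝ) < (1 / 2 : ℝ) ^ P.s := Real.rpow_pos_of_pos (by norm_num) _
    have h34 : (0 : ℝ) < (3 / 4 : ℝ) ^ P.s := Real.rpow_pos_of_pos (by norm_num) _
    have hσ0 : 0 ≤ P.σsp * Real.sqrt (S.Emin n) := (abs_nonneg _).trans hσ
    have hK0 : K ≠ 0 := by
      rw [hK]; exact ne_of_gt (lt_of_lt_of_le (ENNReal.ofReal_pos.2 h12) le_self_add)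
    have hKtop : K ≠ ⊤ := ENNReal.add_ne_top.2 ⟨ENNReal.ofReal_ne_top, ENNReal.ofReal_ne_top⟩
    calc junk 𝒟 P (n + 1) v ≤ ⨅ p : ℝ × ℝ, (K * J P.μ (S.lam n) P.s (v - recon 𝒟 S n p) + L) :=
          le_iInf fun p => junk_succ_le_of_design n v hσ p
      _ = K * junk 𝒟 P n v + L := by
          rw [junk, ENNReal.mul_iInf_of_ne hK0 hKtop, ENNReal.iInf_add]
      _ ≤ K * ENNReal.ofReal (P.jrun * Real.sqrt (S.Emin n)) + L := by gcongr
      _ = ENNReal.ofReal ((((1 / 2 : ℝ) ^ P.s + (3 / 4 : ℝ) ^ P.s) * P.jrun +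
            (3 / 4 : ℝ) ^ P.s * P.σsp) * Real.sqrt (S.Emin n)) := by
          rw [hK, hL, ← ENNReal.ofReal_add h12.le h34.le, ← ENNReal.ofReal_mul (add_pos h12 h34).le,
            ← ENNReal.ofReal_mul hσ0,
            ← ENNReal.ofReal_add (mul_nonneg (add_pos h12 h34).le (mul_nonneg P.jrun_pos.le hE.le))
              (mul_nonneg hσ0 h34.le)]
          congr 1; ring
      _ ≤ ENNReal.ofReal (P.jcore * Real.sqrt (S.Emin (n + 1))) := by
          refine ENNReal.ofReal_le_ofReal ?_
          rw [sqrt_Emin_succ, ← mul_assoc]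
          exact mul_le_mul_of_nonneg_right P.erasure hE.le

end BlockDesign

end Summit.NavierStokesRegularity.FluidComputer

end
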